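import Summits.QuantumAdvantage.QuantumAdvantage.Theorems.SteerDialLevel

/-!
# SteerDial (4/7): SteerDialCylinder

§R — all ring offsets by the rotation symmetry (`rotStrat`, `rotCylinderLoss3_of_polyLoss3`) and §C — GENERAL WORD
LENGTH: `foldBitG`/`wfoldG`, degree `≤ 2+(2m+2)d`, `degree_budgetG`, `cylinderLossG_of_polyLoss3` /
`rotCylinderLossG_of_polyLoss3` (every `m ≥ 1`, every certified identity word, every offset).

Part 4 of 7 of the prover-side twin of the workshop node «SteerDial» (route `SpreadDial`, node on 29065 `CoverLift3`;
lineage decomp-qadv-lens-5, generation 7).  Content verbatim from the monolithic twin `tree/SpreadDialSteer.lean`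
(sha256 5f501baf…, farm rc0 · 0 err · 0 warn · 0 sorry; axioms `propext`/`Classical.choice`/`Quot.sound` for every theorem),
cut at section boundaries to meet the 400-line rule.  No `def … : Prop`, no `instance`, no `notation`.
-/

set_option linter.style.longLine false
set_option linter.dupNamespace false

namespace Summit.QuantumAdvantage.QuantumAdvantage.Theorems.SteerDial

open Finset
open Literature.Computability.QuantumComplexity Literature.Computability.MetaComplexity
open Literature.Computability.QuantumComplexity.RingHLF
open Summit.QuantumAdvantage.AdviceFreeQNC0
open Summit.QuantumAdvantage.QuantumAdvantage.Theses

/-! ## §R  All ring offsets: the cylinder rung transported by the rotation symmetry of the ring game -/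

section Rotation
variable {n : ℕ}

/-- The strategy `P` conjugated by a rotation: `(P^{(s,s')})_b (y) = P_{b+s} (rot_{s'} y)` (used with `s + s' ≡ 0`). -/
def rotStrat {N : ℕ} (s s' : ℕ) (P : Fin N → Smolensky.CubeFn (ZMod 3) N) : Fin N → Smolensky.CubeFn (ZMod 3) N :=
  fun b y => P (RingSymmetry.shift N s b) (rot s' y)

/-- Conjugating by a rotation keeps the degree (substitution by variables). -/
theorem rotStrat_mem_lowDeg {N d : ℕ} (s s' : ℕ) {P : Fin N → Smolensky.CubeFn (ZMod 3) N}
    (hP : ∀ b, P b ∈ Smolensky.lowDeg (ZMod 3) N d) (b : Fin N) :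
    rotStrat s s' P b ∈ Smolensky.lowDeg (ZMod 3) N d :=
  Smolensky.comp_subst_mem_lowDeg (fun y : Fin N → Bool => rot s' y)
    (fun i => Or.inr ⟨RingSymmetry.shift N s' i, fun _ => rfl⟩) (hP _)

/-- **RotCylinderLoss3 (PROVED from PolyLoss3): every identity cylinder at EVERY ring offset.**  For every identity word
`w ∈ {0,1}^6`, every offset `s` and every polylog-degree strategy `P` on `C_{n+6}`, the loss set of `P` has relative density
`≥ 2^6/(n+6)^{k+6}` inside the rotated cylinder `{x : (rot_s x)|_{[n,n+6)} = w}` = `{x : x_{(n+j+s) mod (n+6)} = w_j (j<6)}`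
— all `11·(n+6)` identity cylinders of the ring.  Proof: conjugate `P` by the rotation (`rotStrat`, same degree), apply
`cylinderLoss3_of_polyLoss3`, and pull the losses back with `RingSymmetry.rel_rot` (tree `RingRotation.lean`). -/
theorem rotCylinderLoss3_of_polyLoss3 (hP : SpreadDial.PolyLoss3) :
    ∃ k : ℕ, ∀ c : ℕ, ∃ n₀ : ℕ, ∀ n ≥ n₀, ∀ P : Fin (n + 6) → Smolensky.CubeFn (ZMod 3) (n + 6),
      (∀ b, P b ∈ Smolensky.lowDeg (ZMod 3) (n + 6) ((Nat.log 2 (n + 6)) ^ c)) →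
        ∀ w : Fin 6 → Bool, (∀ s : St, monodromy (List.ofFn w) s = s) → ∀ s : ℕ,
          1 / ((n + 6 : ℕ) : ℝ) ^ k * (2 : ℝ) ^ (n + 6) ≤
            ((univ.filter fun x : Fin (n + 6) → Bool =>
              (∀ j : Fin 6, rot s x (Fin.natAdd n j) = w j) ∧
                ¬ RingHLF.Rel x (fun b => decide (P b x = 1))).card : ℝ) := by
  obtain ⟨k, hk⟩ := cylinderLoss3_of_polyLoss3 hP
  refine ⟨k, fun c => ?_⟩
  obtain ⟨n₀, hn₀⟩ := hk c
  refine ⟨n₀, fun n hn P hPdeg w hw s => ?_⟩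
  set s' := (n + 5) * s with hs'
  have hB := hn₀ n hn (rotStrat s s' P) (fun b => rotStrat_mem_lowDeg s s' hPdeg b) w hw
  refine hB.trans ?_
  have hss : ∀ y : Fin (n + 6) → Bool, rot s (rot s' y) = y := fun y => by
    rw [RingSymmetry.rot_rot, show s + s' = (n + 6) * s by rw [hs']; ring]
    exact RingSymmetry.rot_mul_self s y
  have hle : (univ.filter fun y : Fin (n + 6) → Bool =>
        (∀ j : Fin 6, y (Fin.natAdd n j) = w j) ∧ ¬ RingHLF.Rel y (fun b => decide (rotStrat s s' P b y = 1))).card ≤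
      (univ.filter fun x : Fin (n + 6) → Bool =>
        (∀ j : Fin 6, rot s x (Fin.natAdd n j) = w j) ∧
          ¬ RingHLF.Rel x (fun b => decide (P b x = 1))).card := by
    refine Finset.card_le_card_of_injOn (rot s') (fun y hy => ?_)
      (fun y _ y' _ h => RingSymmetry.rot_injective s' h)
    rw [Finset.mem_coe, Finset.mem_filter] at hy ⊢
    refine ⟨mem_univ _, fun j => by rw [hss]; exact hy.2.1 j, fun hwin => hy.2.2 ?_⟩
    have e : (fun b => decide (rotStrat s s' P b y = 1)) =
        rot s (fun b => decide (P b (rot s' y) = 1)) := rfl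
    rw [e]
    have := (RingSymmetry.rel_rot s (rot s' y) (fun b => decide (P b (rot s' y) = 1))).2 hwin
    rwa [hss] at this
  exact_mod_cast hle

end Rotation

/-! ## §C  General word length and ARBITRARY window content: every contiguous 6-junta cylinder at every offset -/

section GeneralCylinder
variable {n m : ℕ}

/-- The folded strategy's `i`-th output bit along a word of arbitrary length `m`. -/
def foldBitG (w α β : Fin m → Bool) (a b : Bool) (P : Fin (n + m) → Smolensky.CubeFn (ZMod 3) (n + m)) (i : Fin n) :
    (Fin n → Bool) → Bool := fun y => foldOut n α β a b (bits P (pad w y)) i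

/-- SteerDial helper `comp_pad_mem_lowDegG` (lens-5 g7 SteerDial twin; see the enclosing section docstring). -/
theorem comp_pad_mem_lowDegG {d : ℕ} (w : Fin m → Bool) {Q : Smolensky.CubeFn (ZMod 3) (n + m)}
    (hQ : Q ∈ Smolensky.lowDeg (ZMod 3) (n + m) d) :
    (fun y : Fin n → Bool => Q (pad w y)) ∈ Smolensky.lowDeg (ZMod 3) n d := by
  refine Smolensky.comp_subst_mem_lowDeg (fun y : Fin n → Bool => pad w y) (fun b => ?_) hQ
  induction b using Fin.addCases with
  | left i => exact Or.inr ⟨i, fun y => pad_castAdd w y i⟩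
  | right j => exact Or.inl ⟨w j, fun y => pad_natAdd w y j⟩

/-- The block parity along a word of length `m` has degree `≤ 2md`. -/
theorem ind_parityOn_mem_lowDegG {d : ℕ} (w γ : Fin m → Bool) {P : Fin (n + m) → Smolensky.CubeFn (ZMod 3) (n + m)}
    (hP : ∀ b, P b ∈ Smolensky.lowDeg (ZMod 3) (n + m) d) :
    ind (fun y : Fin n → Bool => parityOn n γ (bits P (pad w y))) ∈ Smolensky.lowDeg (ZMod 3) n (2 * m * d) := by
  have h := ind_parity_mem_lowDeg (n := n) (univ.filter fun j : Fin m => γ j = true)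
    (fun j y => decide (P (Fin.natAdd n j) (pad w y) = 1)) (2 * d)
    (fun j _ => ind_decide_mem_lowDeg (comp_pad_mem_lowDegG w (hP _)))
  have hfun : (fun y : Fin n → Bool => parityOn n γ (bits P (pad w y))) = fun y =>
      decide (((univ.filter fun j : Fin m => γ j = true).filter fun j =>
        decide (P (Fin.natAdd n j) (pad w y) = 1) = true).card % 2 = 1) := by
    funext y
    simp only [parityOn, bits, Finset.filter_filter]
  rw [hfun]
  refine Smolensky.lowDeg_mono ?_ h
  have hc : (univ.filter fun j : Fin m => γ j = true).card ≤ m :=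
    (Finset.card_filter_le _ _).trans (by simp)
  calc (univ.filter fun j : Fin m => γ j = true).card * (2 * d) ≤ m * (2 * d) := Nat.mul_le_mul_right _ hc
    _ = 2 * m * d := by ring

/-- Degree of the fold along a word of length `m`: `≤ (2m+2)d`. -/
theorem ind_foldBitG_mem_lowDeg {d : ℕ} (w α β : Fin m → Bool) (a b : Bool)
    {P : Fin (n + m) → Smolensky.CubeFn (ZMod 3) (n + m)} (hP : ∀ b', P b' ∈ Smolensky.lowDeg (ZMod 3) (n + m) d) (i : Fin n) :
    ind (foldBitG w α β a b P i) ∈ Smolensky.lowDeg (ZMod 3) n ((2 * m + 2) * d) := by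
  have hA : ind (fun y : Fin n → Bool => bits P (pad w y) (Fin.castAdd m i)) ∈ Smolensky.lowDeg (ZMod 3) n (2 * d) :=
    ind_decide_mem_lowDeg (comp_pad_mem_lowDegG w (hP _))
  by_cases h1 : i.val = n - 1
  · have hf : foldBitG w α β a b P i = fun y => xor (bits P (pad w y) (Fin.castAdd m i)) (xor (parityOn n α (bits P (pad w y))) a) := by
      funext y; simp only [foldBitG, foldOut, if_pos h1]
    rw [hf, show (2 * m + 2) * d = 2 * d + (2 * m * d + 0) by ring]
    exact ind_xor_mem_lowDeg hA (ind_xor_mem_lowDeg (ind_parityOn_mem_lowDegG w α hP) (ind_const_mem_lowDeg a 0))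
  · by_cases h0 : i.val = 0
    · have hf : foldBitG w α β a b P i = fun y => xor (bits P (pad w y) (Fin.castAdd m i)) (xor (parityOn n β (bits P (pad w y))) b) := by
        funext y; simp only [foldBitG, foldOut, if_neg h1, if_pos h0]
      rw [hf, show (2 * m + 2) * d = 2 * d + (2 * m * d + 0) by ring]
      exact ind_xor_mem_lowDeg hA (ind_xor_mem_lowDeg (ind_parityOn_mem_lowDegG w β hP) (ind_const_mem_lowDeg b 0))
    · have hf : foldBitG w α β a b P i = fun y => bits P (pad w y) (Fin.castAdd m i) := by
        funext y; simp only [foldBitG, foldOut, if_neg h1, if_neg h0, Bool.xor_false]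
      rw [hf]
      exact Smolensky.lowDeg_mono (by nlinarith) hA

/-- The fold of `P` along a word `w` of length `m` with certificate data `(α, β, a, b)`. -/
def wfoldG (w α β : Fin m → Bool) (a b : Bool) (P : Fin (n + m) → Smolensky.CubeFn (ZMod 3) (n + m)) :
    Fin n → Smolensky.CubeFn (ZMod 3) n :=
  fun i => ind (foldBitG w α β a b P i)

/-- SteerDial helper `wfoldG_bits` (lens-5 g7 SteerDial twin; see the enclosing section docstring). -/
theorem wfoldG_bits (w α β : Fin m → Bool) (a b : Bool) (P : Fin (n + m) → Smolensky.CubeFn (ZMod 3) (n + m))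
    (y : Fin n → Bool) :
    (fun i => decide (wfoldG w α β a b P i y = 1)) = foldOut n α β a b (bits P (pad w y)) := by
  funext i
  unfold wfoldG
  rw [decide_ind_eq_one]
  rfl

/-- Loss count transport along a certified word of length `m ≥ 1`. -/
theorem card_loss_wfoldG_le (hn : 3 ≤ n) (hm : 1 ≤ m) {w α β : Fin m → Bool} {a b : Bool} (cert : wordCert w α β a b = true)
    (P : Fin (n + m) → Smolensky.CubeFn (ZMod 3) (n + m)) :
    (univ.filter fun y : Fin n → Bool => ¬ RingHLF.Rel y (fun i => decide (wfoldG w α β a b P i y = 1))).card ≤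
      (univ.filter fun x : Fin (n + m) → Bool =>
        (∀ j : Fin m, x (Fin.natAdd n j) = w j) ∧ ¬ RingHLF.Rel x (fun b' => decide (P b' x = 1))).card := by
  refine Finset.card_le_card_of_injOn (pad w) (fun y hy => ?_) (fun y _ y' _ h => ?_)
  · rw [Finset.mem_coe, Finset.mem_filter] at hy ⊢
    refine ⟨mem_univ _, fun j => pad_natAdd _ _ _, fun hwin => hy.2 ?_⟩
    rw [wfoldG_bits]
    exact rel_fold hn hm cert y _ hwin
  · funext i
    have := congrFun h (Fin.castAdd m i)
    simpa [pad_castAdd] using this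

/-- Degree budget along a word of length `m`: `2 + (2m+2)(log₂(n+m))^c ≤ (log₂ n)^(2c+1)` for `n ≥ 2^(2m+4)`. -/
theorem degree_budgetG (m c : ℕ) : ∀ n ≥ 2 ^ (2 * m + 4), 2 + (2 * m + 2) * (Nat.log 2 (n + m)) ^ c ≤ (Nat.log 2 n) ^ (2 * c + 1) := by
  intro n hn
  set L := Nat.log 2 n with hL
  have hLm : 2 * m + 4 ≤ L := Nat.le_log_of_pow_le (by norm_num) hn
  have hmn : m ≤ n := by
    have h1 : m < 2 ^ m := Nat.lt_two_pow_self
    have h2 : 2 ^ m ≤ 2 ^ (2 * m + 4) := Nat.pow_le_pow_right (by norm_num) (by omega)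
    omega
  have hn0 : n ≠ 0 := by
    have h := @Nat.one_le_two_pow (2 * m + 4)
    omega
  have hlog : Nat.log 2 (n + m) ≤ L + 1 := by
    calc Nat.log 2 (n + m) ≤ Nat.log 2 (n * 2) := Nat.log_mono_right (by omega)
      _ = L + 1 := by rw [Nat.log_mul_base (by norm_num) hn0]
  have h1 : (Nat.log 2 (n + m)) ^ c ≤ L ^ (2 * c) := by
    calc (Nat.log 2 (n + m)) ^ c ≤ (L + 1) ^ c := Nat.pow_le_pow_left hlog c
      _ ≤ (2 * L) ^ c := Nat.pow_le_pow_left (by omega) c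
      _ = 2 ^ c * L ^ c := by rw [Nat.mul_pow]
      _ ≤ L ^ c * L ^ c := Nat.mul_le_mul_right _ (Nat.pow_le_pow_left (by omega) c)
      _ = L ^ (2 * c) := by rw [← pow_add, two_mul]
  have h2 : 1 ≤ L ^ (2 * c) := Nat.one_le_pow _ _ (by omega)
  calc 2 + (2 * m + 2) * (Nat.log 2 (n + m)) ^ c ≤ 2 + (2 * m + 2) * L ^ (2 * c) :=
        Nat.add_le_add_left (Nat.mul_le_mul_left _ h1) _
    _ ≤ (2 * m + 4) * L ^ (2 * c) := by nlinarith
    _ ≤ L * L ^ (2 * c) := Nat.mul_le_mul_right _ hLm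
    _ = L ^ (2 * c + 1) := by rw [pow_succ, mul_comm]

/-- **CylinderLossG (PROVED from PolyLoss3; every word length).**  For every CERTIFIED identity word `w ∈ {0,1}^m`
(`m ≥ 1`, `wordCert w α β a b = true`) every polylog-degree strategy on `C_{n+m}` loses on `≥ 2^{n+m}/(n+m)^{k+m}` inputs inside
the cylinder `{x : x|_{[n,n+m)} = w}` (`k ↦ k+m`, `c ↦ 2c+1`, `n₀ ↦ max n₀ 2^(2m+4)`). -/
theorem cylinderLossG_of_polyLoss3 (hP : SpreadDial.PolyLoss3) (m : ℕ) (hm : 1 ≤ m) :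
    ∃ k : ℕ, ∀ c : ℕ, ∃ n₀ : ℕ, ∀ n ≥ n₀, ∀ P : Fin (n + m) → Smolensky.CubeFn (ZMod 3) (n + m),
      (∀ b, P b ∈ Smolensky.lowDeg (ZMod 3) (n + m) ((Nat.log 2 (n + m)) ^ c)) →
        ∀ w α β : Fin m → Bool, ∀ a b : Bool, wordCert w α β a b = true →
          1 / ((n + m : ℕ) : ℝ) ^ k * (2 : ℝ) ^ (n + m) ≤
            ((univ.filter fun x : Fin (n + m) → Bool =>
              (∀ j : Fin m, x (Fin.natAdd n j) = w j) ∧ ¬ RingHLF.Rel x (fun b => decide (P b x = 1))).card : ℝ) := by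
  obtain ⟨k, hk⟩ := hP
  refine ⟨k + m, fun c => ?_⟩
  obtain ⟨n₀, hn₀⟩ := hk (2 * c + 1)
  refine ⟨max n₀ (2 ^ (2 * m + 4)), fun n hn P hPdeg w α β a b cert => ?_⟩
  have hn₀' : n₀ ≤ n := le_trans (le_max_left _ _) hn
  have hnM : 2 ^ (2 * m + 4) ≤ n := le_trans (le_max_right _ _) hn
  have hn3 : 3 ≤ n := by
    have : 2 ^ 4 ≤ 2 ^ (2 * m + 4) := Nat.pow_le_pow_right (by norm_num) (by omega)
    omega
  set S := wfoldG w α β a b P with hS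
  have hSdeg : ∀ i, S i ∈ Smolensky.lowDeg (ZMod 3) n ((Nat.log 2 n) ^ (2 * c + 1)) := fun i =>
    Smolensky.lowDeg_mono ((Nat.le_add_left _ _).trans (degree_budgetG m c n hnM)) (ind_foldBitG_mem_lowDeg _ _ _ _ _ hPdeg i)
  have hwin := hn₀ n hn₀' S hSdeg
  have hsum := card_win_add_card_loss (fun y : Fin n → Bool => RingHLF.Rel y (fun i => decide (S i y = 1)))
  have hloss : 1 / (n : ℝ) ^ k * (2 : ℝ) ^ n ≤
      ((univ.filter fun y : Fin n → Bool => ¬ RingHLF.Rel y (fun i => decide (S i y = 1))).card : ℝ) := by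
    have e : (1 - 1 / (n : ℝ) ^ k) * (2 : ℝ) ^ n = (2 : ℝ) ^ n - 1 / (n : ℝ) ^ k * (2 : ℝ) ^ n := by ring
    linarith
  have htr' : ((univ.filter fun y : Fin n → Bool => ¬ RingHLF.Rel y (fun i => decide (S i y = 1))).card : ℝ) ≤
      ((univ.filter fun x : Fin (n + m) → Bool =>
        (∀ j : Fin m, x (Fin.natAdd n j) = w j) ∧ ¬ RingHLF.Rel x (fun b => decide (P b x = 1))).card : ℝ) := by
    exact_mod_cast card_loss_wfoldG_le hn3 hm cert P
  have hnpos : (0 : ℝ) < n := by exact_mod_cast (show 0 < n by omega)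
  have hcmp : 1 / ((n + m : ℕ) : ℝ) ^ (k + m) * (2 : ℝ) ^ (n + m) ≤ 1 / (n : ℝ) ^ k * (2 : ℝ) ^ n := by
    have hNk : (n : ℝ) ^ k * (2 : ℝ) ^ m ≤ ((n + m : ℕ) : ℝ) ^ (k + m) := by
      push_cast
      rw [pow_add]
      have h2m : (2 : ℝ) ^ m ≤ ((n : ℝ) + m) ^ m := pow_le_pow_left₀ (by norm_num) (by
        have : (3 : ℝ) ≤ n := by exact_mod_cast hn3
        have : (0 : ℝ) ≤ m := by positivity
        linarith) m
      have hk' : (n : ℝ) ^ k ≤ ((n : ℝ) + m) ^ k := pow_le_pow_left₀ hnpos.le (by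
        have : (0 : ℝ) ≤ m := by positivity
        linarith) k
      exact mul_le_mul hk' h2m (by positivity) (by positivity)
    have hpos : (0 : ℝ) < (n : ℝ) ^ k * (2 : ℝ) ^ m := by positivity
    calc 1 / ((n + m : ℕ) : ℝ) ^ (k + m) * (2 : ℝ) ^ (n + m)
        ≤ 1 / ((n : ℝ) ^ k * (2 : ℝ) ^ m) * (2 : ℝ) ^ (n + m) :=
          mul_le_mul_of_nonneg_right (one_div_le_one_div_of_le hpos hNk) (by positivity)
      _ = 1 / (n : ℝ) ^ k * (2 : ℝ) ^ n := by
          rw [pow_add]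
          field_simp
  exact hcmp.trans (hloss.trans htr')

/-- **RotCylinderLossG**: the same inside the rotated cylinder `{x : (rot_s x)|_{[n,n+m)} = w}`, every offset `s`. -/
theorem rotCylinderLossG_of_polyLoss3 (hP : SpreadDial.PolyLoss3) (m : ℕ) (hm : 1 ≤ m) :
    ∃ k : ℕ, ∀ c : ℕ, ∃ n₀ : ℕ, ∀ n ≥ n₀, ∀ P : Fin (n + m) → Smolensky.CubeFn (ZMod 3) (n + m),
      (∀ b, P b ∈ Smolensky.lowDeg (ZMod 3) (n + m) ((Nat.log 2 (n + m)) ^ c)) →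
        ∀ w α β : Fin m → Bool, ∀ a b : Bool, wordCert w α β a b = true → ∀ s : ℕ,
          1 / ((n + m : ℕ) : ℝ) ^ k * (2 : ℝ) ^ (n + m) ≤
            ((univ.filter fun x : Fin (n + m) → Bool =>
              (∀ j : Fin m, rot s x (Fin.natAdd n j) = w j) ∧
                ¬ RingHLF.Rel x (fun b => decide (P b x = 1))).card : ℝ) := by
  obtain ⟨k, hk⟩ := cylinderLossG_of_polyLoss3 hP m hm
  refine ⟨k, fun c => ?_⟩
  obtain ⟨n₀, hn₀⟩ := hk c
  refine ⟨n₀, fun n hn P hPdeg w α β a b cert s => ?_⟩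
  set s' := (n + m - 1) * s with hs'
  have hB := hn₀ n hn (rotStrat s s' P) (fun b => rotStrat_mem_lowDeg s s' hPdeg b) w α β a b cert
  refine hB.trans ?_
  have hss : ∀ y : Fin (n + m) → Bool, rot s (rot s' y) = y := fun y => by
    have hnm : n + m - 1 + 1 = n + m := by omega
    rw [RingSymmetry.rot_rot, show s + s' = (n + m) * s by
      rw [hs']
      calc s + (n + m - 1) * s = (n + m - 1 + 1) * s := by ring
        _ = (n + m) * s := by rw [hnm]]
    exact RingSymmetry.rot_mul_self s y
  have hle : (univ.filter fun y : Fin (n + m) → Bool =>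
        (∀ j : Fin m, y (Fin.natAdd n j) = w j) ∧ ¬ RingHLF.Rel y (fun b => decide (rotStrat s s' P b y = 1))).card ≤
      (univ.filter fun x : Fin (n + m) → Bool =>
        (∀ j : Fin m, rot s x (Fin.natAdd n j) = w j) ∧
          ¬ RingHLF.Rel x (fun b => decide (P b x = 1))).card := by
    refine Finset.card_le_card_of_injOn (rot s') (fun y hy => ?_)
      (fun y _ y' _ h => RingSymmetry.rot_injective s' h)
    rw [Finset.mem_coe, Finset.mem_filter] at hy ⊢
    refine ⟨mem_univ _, fun j => by rw [hss]; exact hy.2.1 j, fun hwin => hy.2.2 ?_⟩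
    have e : (fun b => decide (rotStrat s s' P b y = 1)) =
        rot s (fun b => decide (P b (rot s' y) = 1)) := rfl
    rw [e]
    have := (RingSymmetry.rel_rot s (rot s' y) (fun b => decide (P b (rot s' y) = 1))).2 hwin
    rwa [hss] at this
  exact_mod_cast hle

/-! ### Arbitrary window CONTENT: complete `w₀ ∈ {0,1}^6` to an identity word `vinv w₀ ++ w₀ ∈ {0,1}^12` -/

end GeneralCylinder

end Summit.QuantumAdvantage.QuantumAdvantage.Theorems.SteerDial
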